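import Summits.AtomisticToContinuum.HydrodynamicLimit.Theorems.InformationPercolationEngineChaosClosesEulerReductionFields
import Summits.AtomisticToContinuum.HydrodynamicLimit.Theorems.InformationPercolationEngineChaosClosesEulerEnskogTensor
import Summits.AtomisticToContinuum.HydrodynamicLimit.Theorems.JParityClosureEvenStressEnskogEnskogIdentificationWeight
import Literature.MathematicalPhysics.KineticTheory.HardSphereCrossSection
import Literature.MathematicalPhysics.KineticTheory.EvenStatTruncationBound
import HarnessLib

/-!
# Collisional pressure value in band (crux `ChaosClosesEuler`, stmt-AtomisticToContinuum-15141, line `Sketch`,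
# stub `stub_pressureValueOfEnskog`) — helper A: the truncated stress marks and their sphere integrals

WHAT. Elementary objects of the proof of the registered stub `stub_pressureValueOfEnskog`
(`CollisionalPressureValueInBand` from pointwise Enskog collision statistics), written with the tree's speed
cutoff `ψ_L(‖v‖) = speedCutoff L ‖v‖` (`= 1` on `‖v‖ ≤ L`, `= 0` on `‖v‖ ≥ 2L`, `0 < L`) and coordinate clip `clip1`
(no new constant is introduced; the two marks are local notations for explicit lambdas):

* the TRUNCATED stress marks `𝒯[L,k,l] (ω, v, w) = min |⟪v − w, ω⟫| (4L) · ψ_L(‖v‖) ψ_L(‖w‖) · clip ω_k clip ω_l`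
  (bounded by `4L`, continuous; at a unit normal `= |⟪v − w, ω⟫| ψ_L ψ_L ω_k ω_l`) and the nonnegative dominating
  mark `ℬ[L] (ω, v, w) = 4L ψ_L(‖v‖) ψ_L(‖w‖)`;
* their sphere integrals against the hard-sphere flux `((w − v)·ω)₊` (`sphereMark`):
  `Θ(𝒯) v w = ψ_L ψ_L · (2π/15)(‖w − v‖² δ_kl + 2(w − v)_k (w − v)_l)` (the landed Enskog tensor identity
  `ChaosClosesEulerEnskogTensor.stub_enskogTensorIdentity`, since `|a| · a₊ = a₊²`) and
  `Θ(ℬ) v w = 4L ψ_L ψ_L · π‖w − v‖ ∈ [0, 16πL² ψ_L ψ_L]` (`integral_hardSphereKernel_eq_pi_mul_norm`);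
* the velocity-truncation inequality `|⟪v − w, n̂⟫| (1 − ψ_L ψ_L) ≤ (1 + ‖v‖² + ‖w‖²) 1{L² < ‖v‖² + ‖w‖²}` at a unit
  normal (the remainder is the quadratic collision mark of `CollisionMomentUI`).

References: S. Chapman, T. G. Cowling, *The Mathematical Theory of Non-Uniform Gases* (1970) §16.4;
P. Résibois, M. De Leener, *Classical Kinetic Theory of Fluids* (1977) Ch. VI §3.
-/

noncomputable section

namespace Summit.AtomisticToContinuum.HydrodynamicLimit.Theorems.ChaosClosesEulerPressureValue

open scoped BigOperators Topology Classical MeasureTheory ENNReal InnerProductSpace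
open Filter Set MeasureTheory
open Literature.MathematicalPhysics.KineticTheory
open Literature.Analysis.FluidPDE
open Summit.AtomisticToContinuum.HydrodynamicLimit.Theorems.LocalSecondLawNegative
open Summit.AtomisticToContinuum.HydrodynamicLimit.Theorems.LocalSecondLawLedger
open Summit.AtomisticToContinuum.HydrodynamicLimit.Theorems.LocalSecondLawLedger.L
  (Mmom rhoC_eq_sum momC_apply_eq_sum momC_eq_sum kinC_eq_trace norm_sq_eq_sum)

/-- The truncated stress mark `𝒯[L,k,l]` (local notation for an explicit lambda). -/
local notation3 "𝒯[" L ", " k ", " l "]" => fun q : V3 × V3 × V3 =>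
  min |⟪q.2.1 - q.2.2, q.1⟫_ℝ| (4 * L) * (speedCutoff L ‖q.2.1‖ * speedCutoff L ‖q.2.2‖) * (clip1 (q.1 k) * clip1 (q.1 l))

/-- The dominating mark `ℬ[L]` (local notation for an explicit lambda). -/
local notation3 "ℬ[" L "]" => fun q : V3 × V3 × V3 => 4 * L * (speedCutoff L ‖q.2.1‖ * speedCutoff L ‖q.2.2‖)

/-! ## §1 The speed cutoff of one velocity -/

/-- Where the cutoff does not vanish the speed is `< 2L` (`0 < L`). [folklore] -/
theorem norm_lt_of_speedCutoff_ne_zero {L : ℝ} (hL : 0 < L) {v : V3} (h : speedCutoff L ‖v‖ ≠ 0) :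
    ‖v‖ < 2 * L := by
  by_contra hv
  exact h (speedCutoff_eq_zero hL (not_lt.1 hv))

/-- Where the cutoff is `< 1` the speed is `> L` (`0 < L`). [folklore] -/
theorem lt_norm_of_speedCutoff_lt_one {L : ℝ} (hL : 0 < L) {v : V3} (h : speedCutoff L ‖v‖ < 1) : L < ‖v‖ := by
  by_contra hv
  rw [speedCutoff_eq_one hL (not_lt.1 hv)] at h
  exact lt_irrefl _ h

/-- The cutoff is continuous in the velocity. [folklore] -/
theorem continuous_speedCutoff_norm (L : ℝ) : Continuous fun v : V3 => speedCutoff L ‖v‖ := by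
  unfold speedCutoff; fun_prop

/-- `|ψ_L(‖v‖)| ≤ 1`. [folklore] -/
theorem abs_speedCutoff_norm_le (L : ℝ) (v : V3) : |speedCutoff L ‖v‖| ≤ 1 := by
  have h := speedCutoff_mem_Icc L ‖v‖
  rw [abs_of_nonneg h.1]; exact h.2

/-- The product of two cutoffs lies in `[0, 1]`. [folklore] -/
theorem cc_mem (L : ℝ) (v w : V3) :
    0 ≤ speedCutoff L ‖v‖ * speedCutoff L ‖w‖ ∧ speedCutoff L ‖v‖ * speedCutoff L ‖w‖ ≤ 1 :=
  ⟨mul_nonneg (speedCutoff_mem_Icc L _).1 (speedCutoff_mem_Icc L _).1,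
    mul_le_one₀ (speedCutoff_mem_Icc L _).2 (speedCutoff_mem_Icc L _).1 (speedCutoff_mem_Icc L _).2⟩

/-- Where the product of two cutoffs does not vanish, `‖v − w‖ ≤ 4L` (`0 < L`). [folklore] -/
theorem norm_sub_le_of_cc_ne_zero {L : ℝ} (hL : 0 < L) {v w : V3}
    (h : speedCutoff L ‖v‖ * speedCutoff L ‖w‖ ≠ 0) : ‖v - w‖ ≤ 4 * L := by
  have hv := norm_lt_of_speedCutoff_ne_zero hL (left_ne_zero_of_mul h)
  have hw := norm_lt_of_speedCutoff_ne_zero hL (right_ne_zero_of_mul h)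
  linarith [norm_sub_le v w]

/-- **Velocity truncation of the stress mark.** At a unit normal,
`|⟪v − w, n⟫| (1 − ψ_L(‖v‖) ψ_L(‖w‖)) ≤ (1 + ‖v‖² + ‖w‖²) 1{L² < ‖v‖² + ‖w‖²}` (`0 < L`). [folklore] -/
theorem abs_inner_mul_one_sub_cc_le {L : ℝ} (hL : 0 < L) {n : V3} (hn : ‖n‖ = 1) (v w : V3) :
    |⟪v - w, n⟫_ℝ| * (1 - speedCutoff L ‖v‖ * speedCutoff L ‖w‖) ≤
      (if L ^ 2 < ‖v‖ ^ 2 + ‖w‖ ^ 2 then 1 + ‖v‖ ^ 2 + ‖w‖ ^ 2 else 0) := by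
  have hcc := cc_mem L v w
  by_cases h1 : speedCutoff L ‖v‖ * speedCutoff L ‖w‖ = 1
  · rw [h1, sub_self, mul_zero]; split_ifs <;> positivity
  · have hlt : speedCutoff L ‖v‖ * speedCutoff L ‖w‖ < 1 := lt_of_le_of_ne hcc.2 h1
    have hfast : L ^ 2 < ‖v‖ ^ 2 + ‖w‖ ^ 2 := by
      by_cases hv : speedCutoff L ‖v‖ < 1
      · have := lt_norm_of_speedCutoff_lt_one hL hv
        nlinarith [norm_nonneg v, norm_nonneg w]
      · have hv1 : speedCutoff L ‖v‖ = 1 := le_antisymm (speedCutoff_mem_Icc L _).2 (not_lt.1 hv)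
        rw [hv1, one_mul] at hlt
        have := lt_norm_of_speedCutoff_lt_one hL hlt
        nlinarith [norm_nonneg v, norm_nonneg w]
    rw [if_pos hfast]
    have hin : |⟪v - w, n⟫_ℝ| ≤ ‖v‖ + ‖w‖ := by
      calc |⟪v - w, n⟫_ℝ| ≤ ‖v - w‖ * ‖n‖ := abs_real_inner_le_norm _ _
        _ = ‖v - w‖ := by rw [hn, mul_one]
        _ ≤ ‖v‖ + ‖w‖ := norm_sub_le v w
    have h2 : ‖v‖ + ‖w‖ ≤ 1 + ‖v‖ ^ 2 + ‖w‖ ^ 2 := by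
      nlinarith [sq_nonneg (‖v‖ - 1), sq_nonneg (‖w‖ - 1), norm_nonneg v, norm_nonneg w]
    calc |⟪v - w, n⟫_ℝ| * (1 - speedCutoff L ‖v‖ * speedCutoff L ‖w‖) ≤ (‖v‖ + ‖w‖) * 1 :=
          mul_le_mul hin (by linarith [hcc.1]) (by linarith [hcc.2]) (by positivity)
      _ ≤ 1 + ‖v‖ ^ 2 + ‖w‖ ^ 2 := by linarith

/-! ## §2 The truncated stress marks -/

/-- The truncated stress mark is continuous. [folklore] -/
theorem continuous_markT (L : ℝ) (k l : Fin 3) : Continuous 𝒯[L, k, l] := by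
  unfold clip1 speedCutoff
  fun_prop

/-- The dominating mark is continuous. [folklore] -/
theorem continuous_markB (L : ℝ) : Continuous ℬ[L] := by
  unfold speedCutoff
  fun_prop

/-- The dominating mark is nonnegative (`0 < L`). [folklore] -/
theorem markB_nonneg {L : ℝ} (hL : 0 < L) (q : V3 × V3 × V3) : 0 ≤ ℬ[L] q :=
  mul_nonneg (by linarith) (cc_mem L _ _).1

/-- `ℬ ≤ 4L` (`0 < L`). [folklore] -/
theorem markB_le {L : ℝ} (hL : 0 < L) (q : V3 × V3 × V3) : ℬ[L] q ≤ 4 * L := by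
  have h := (cc_mem L q.2.1 q.2.2).2
  dsimp only
  nlinarith

/-- `|𝒯| ≤ ℬ` pointwise (`0 < L`). [folklore] -/
theorem abs_markT_le_markB {L : ℝ} (hL : 0 < L) (k l : Fin 3) (q : V3 × V3 × V3) :
    |𝒯[L, k, l] q| ≤ ℬ[L] q := by
  dsimp only
  have hcc := cc_mem L q.2.1 q.2.2
  have hm0 : 0 ≤ min |⟪q.2.1 - q.2.2, q.1⟫_ℝ| (4 * L) := le_min (abs_nonneg _) (by linarith)
  have hmL : min |⟪q.2.1 - q.2.2, q.1⟫_ℝ| (4 * L) ≤ 4 * L := min_le_right _ _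
  have hc : |clip1 (q.1 k) * clip1 (q.1 l)| ≤ 1 := by
    rw [abs_mul]
    exact mul_le_one₀ (abs_clip1_le _) (abs_nonneg _) (abs_clip1_le _)
  rw [abs_mul, abs_mul, abs_of_nonneg hm0, abs_of_nonneg hcc.1]
  calc min |⟪q.2.1 - q.2.2, q.1⟫_ℝ| (4 * L) * (speedCutoff L ‖q.2.1‖ * speedCutoff L ‖q.2.2‖) *
        |clip1 (q.1 k) * clip1 (q.1 l)|
      ≤ 4 * L * (speedCutoff L ‖q.2.1‖ * speedCutoff L ‖q.2.2‖) * 1 :=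
        mul_le_mul (mul_le_mul_of_nonneg_right hmL hcc.1) hc (abs_nonneg _) (mul_nonneg (by linarith) hcc.1)
    _ = 4 * L * (speedCutoff L ‖q.2.1‖ * speedCutoff L ‖q.2.2‖) := mul_one _

/-- `|𝒯| ≤ 4L` (`0 < L`). [folklore] -/
theorem abs_markT_le {L : ℝ} (hL : 0 < L) (k l : Fin 3) (q : V3 × V3 × V3) : |𝒯[L, k, l] q| ≤ 4 * L :=
  (abs_markT_le_markB hL k l q).trans (markB_le hL q)

/-- A bound witness for `𝒯` in the form consumed by the pointwise Enskog collision statistics. [folklore] -/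
theorem exists_abs_markT_le {L : ℝ} (hL : 0 < L) (k l : Fin 3) : ∃ C : ℝ, ∀ q, |𝒯[L, k, l] q| ≤ C :=
  ⟨4 * L, abs_markT_le hL k l⟩

/-- A bound witness for `ℬ`. [folklore] -/
theorem exists_abs_markB_le {L : ℝ} (hL : 0 < L) : ∃ C : ℝ, ∀ q, |ℬ[L] q| ≤ C :=
  ⟨4 * L, fun q => by rw [abs_of_nonneg (markB_nonneg hL q)]; exact markB_le hL q⟩

/-- **At a unit normal the truncation of the normal and of the impact speed is invisible**:
`𝒯[L,k,l] (ω, v, w) = |⟪v − w, ω⟫| ψ_L ψ_L ω_k ω_l` whenever `‖ω‖ = 1` (`0 < L`). [folklore] -/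
theorem markT_eq_of_norm_eq_one {L : ℝ} (hL : 0 < L) (k l : Fin 3) {ω : V3} (hω : ‖ω‖ = 1) (v w : V3) :
    𝒯[L, k, l] (ω, v, w) = |⟪v - w, ω⟫_ℝ| * (speedCutoff L ‖v‖ * speedCutoff L ‖w‖) * (ω k * ω l) := by
  dsimp only
  have hk : |ω k| ≤ 1 := by
    have := PiLp.norm_apply_le ω k
    rwa [hω, Real.norm_eq_abs] at this
  have hl : |ω l| ≤ 1 := by
    have := PiLp.norm_apply_le ω l
    rwa [hω, Real.norm_eq_abs] at this
  rw [clip1_eq_self hk, clip1_eq_self hl]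
  by_cases hcc : speedCutoff L ‖v‖ * speedCutoff L ‖w‖ = 0
  · rw [hcc]; ring
  · have hin : |⟪v - w, ω⟫_ℝ| ≤ 4 * L := by
      calc |⟪v - w, ω⟫_ℝ| ≤ ‖v - w‖ * ‖ω‖ := abs_real_inner_le_norm _ _
        _ = ‖v - w‖ := by rw [hω, mul_one]
        _ ≤ 4 * L := norm_sub_le_of_cc_ne_zero hL hcc
    rw [min_eq_left hin]

/-! ## §3 Sphere integrals of the marks -/

/-- `|a| · max (−a) 0 = (max (−a) 0)²`, in the form `|⟪v − w, ω⟫| ((w − v)·ω)₊ = ((w − v)·ω)₊²`. [folklore] -/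
theorem abs_inner_mul_posPart (v w ω : V3) :
    |⟪v - w, ω⟫_ℝ| * max ⟪w - v, ω⟫_ℝ 0 = (max ⟪w - v, ω⟫_ℝ 0) ^ 2 := by
  have h : ⟪v - w, ω⟫_ℝ = -⟪w - v, ω⟫_ℝ := by rw [← inner_neg_left, neg_sub]
  rw [h, abs_neg]
  rcases le_total 0 ⟪w - v, ω⟫_ℝ with h0 | h0
  · rw [abs_of_nonneg h0, max_eq_left h0, sq]
  · rw [max_eq_right h0]; ring

/-- **The sphere integral of the truncated stress mark** (Enskog tensor identity):
`Θ(𝒯[L,k,l]) v w = ψ_L(‖v‖) ψ_L(‖w‖) · (2π/15)(‖w − v‖² δ_kl + 2 (w − v)_k (w − v)_l)` (`0 < L`).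
[cite: ChapmanCowling1970, §16.4] -/
theorem sphereMark_markT {L : ℝ} (hL : 0 < L) (k l : Fin 3) (v w : V3) :
    sphereMark 𝒯[L, k, l] v w = speedCutoff L ‖v‖ * speedCutoff L ‖w‖ *
      (2 * Real.pi / 15 * (‖w - v‖ ^ 2 * (if k = l then 1 else 0) + 2 * ((w - v) k * (w - v) l))) := by
  unfold sphereMark
  have hpt : ∀ ω : Metric.sphere (0 : V3) 1, 𝒯[L, k, l] ((ω : V3), v, w) * hardSphereKernel (w, v) ω =
      speedCutoff L ‖v‖ * speedCutoff L ‖w‖ * ((max ⟪w - v, (ω : V3)⟫_ℝ 0) ^ 2 * ((ω : V3) k * (ω : V3) l)) := by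
    intro ω
    rw [markT_eq_of_norm_eq_one hL k l (norm_coe_unitSphere ω), hardSphereKernel]
    dsimp only
    rw [← abs_inner_mul_posPart v w (ω : V3)]
    ring
  simp_rw [hpt]
  rw [integral_const_mul, ChaosClosesEulerEnskogTensor.stub_enskogTensorIdentity (w - v) k l]

/-- **The sphere integral of the dominating mark**: `Θ(ℬ[L]) v w = 4L ψ_L ψ_L · π‖w − v‖`. [folklore] -/
theorem sphereMark_markB (L : ℝ) (v w : V3) :
    sphereMark ℬ[L] v w = 4 * L * (speedCutoff L ‖v‖ * speedCutoff L ‖w‖) * (Real.pi * ‖w - v‖) := by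
  unfold sphereMark
  dsimp only
  rw [integral_const_mul, integral_hardSphereKernel_eq_pi_mul_norm]

/-- `0 ≤ Θ(ℬ[L]) v w ≤ 16πL² ψ_L ψ_L` (`0 < L`). [folklore] -/
theorem sphereMark_markB_mem {L : ℝ} (hL : 0 < L) (v w : V3) :
    0 ≤ sphereMark ℬ[L] v w ∧
      sphereMark ℬ[L] v w ≤ 16 * Real.pi * L ^ 2 * (speedCutoff L ‖v‖ * speedCutoff L ‖w‖) := by
  rw [sphereMark_markB]
  have hcc := cc_mem L v w
  refine ⟨mul_nonneg (mul_nonneg (by linarith) hcc.1) (by positivity), ?_⟩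
  by_cases h0 : speedCutoff L ‖v‖ * speedCutoff L ‖w‖ = 0
  · rw [h0]; simp
  · have hvw : ‖w - v‖ ≤ 4 * L := by
      rw [norm_sub_rev]; exact norm_sub_le_of_cc_ne_zero hL h0
    calc 4 * L * (speedCutoff L ‖v‖ * speedCutoff L ‖w‖) * (Real.pi * ‖w - v‖)
        ≤ 4 * L * (speedCutoff L ‖v‖ * speedCutoff L ‖w‖) * (Real.pi * (4 * L)) := by
          gcongr
          exact mul_nonneg (by linarith) hcc.1
      _ = 16 * Real.pi * L ^ 2 * (speedCutoff L ‖v‖ * speedCutoff L ‖w‖) := by ring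

/-- `|Θ(𝒯[L,k,l]) v w| ≤ (2π/5) ‖w − v‖² ψ_L ψ_L` (`0 < L`). [folklore] -/
theorem abs_sphereMark_markT_le {L : ℝ} (hL : 0 < L) (k l : Fin 3) (v w : V3) :
    |sphereMark 𝒯[L, k, l] v w| ≤ 2 * Real.pi / 5 * ‖w - v‖ ^ 2 * (speedCutoff L ‖v‖ * speedCutoff L ‖w‖) := by
  rw [sphereMark_markT hL]
  have hcc := cc_mem L v w
  have hk : |(w - v) k * (w - v) l| ≤ ‖w - v‖ ^ 2 := by
    rw [abs_mul]
    have h1 : |(w - v) k| ≤ ‖w - v‖ := by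
      have := PiLp.norm_apply_le (w - v) k; rwa [Real.norm_eq_abs] at this
    have h2 : |(w - v) l| ≤ ‖w - v‖ := by
      have := PiLp.norm_apply_le (w - v) l; rwa [Real.norm_eq_abs] at this
    calc |(w - v) k| * |(w - v) l| ≤ ‖w - v‖ * ‖w - v‖ :=
          mul_le_mul h1 h2 (abs_nonneg _) (norm_nonneg _)
      _ = ‖w - v‖ ^ 2 := (sq _).symm
  have hδ : |‖w - v‖ ^ 2 * (if k = l then (1 : ℝ) else 0)| ≤ ‖w - v‖ ^ 2 := by
    split_ifs
    · rw [mul_one, abs_of_nonneg (sq_nonneg _)]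
    · rw [mul_zero, abs_zero]; positivity
  rw [abs_mul, abs_of_nonneg hcc.1, abs_mul, abs_of_nonneg (by positivity : (0 : ℝ) ≤ 2 * Real.pi / 15)]
  have hsum : |‖w - v‖ ^ 2 * (if k = l then (1 : ℝ) else 0) + 2 * ((w - v) k * (w - v) l)| ≤ 3 * ‖w - v‖ ^ 2 := by
    refine (abs_add_le _ _).trans ?_
    rw [abs_mul (2 : ℝ), abs_two]
    linarith
  calc speedCutoff L ‖v‖ * speedCutoff L ‖w‖ * (2 * Real.pi / 15 *
        |‖w - v‖ ^ 2 * (if k = l then (1 : ℝ) else 0) + 2 * ((w - v) k * (w - v) l)|)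
      ≤ speedCutoff L ‖v‖ * speedCutoff L ‖w‖ * (2 * Real.pi / 15 * (3 * ‖w - v‖ ^ 2)) := by
        gcongr; exact hcc.1
    _ = 2 * Real.pi / 5 * ‖w - v‖ ^ 2 * (speedCutoff L ‖v‖ * speedCutoff L ‖w‖) := by ring

/-- The sphere integral of `𝒯` is jointly continuous in the two velocities. [folklore] -/
theorem continuous_sphereMark_markT (L : ℝ) (k l : Fin 3) :
    Continuous fun p : V3 × V3 => sphereMark 𝒯[L, k, l] p.1 p.2 :=
  continuous_sphereMark_uncurry (continuous_markT L k l)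

/-- The sphere integral of `ℬ` is jointly continuous in the two velocities. [folklore] -/
theorem continuous_sphereMark_markB (L : ℝ) :
    Continuous fun p : V3 × V3 => sphereMark ℬ[L] p.1 p.2 :=
  continuous_sphereMark_uncurry (continuous_markB L)

/-! ## §4 Registered sub-goal -/

/-- **Registered sub-goal `stub_pressureValueA` (helper A of `stub_pressureValueOfEnskog`): velocity truncation of
the stress mark at a unit normal**, `|⟪v − w, n⟫| (1 − ψ_L ψ_L) ≤ (1 + ‖v‖² + ‖w‖²) 1{L² < ‖v‖² + ‖w‖²}`. [folklore] -/
theorem stub_pressureValueA : ∀ {L : ℝ}, 0 < L → ∀ {n : V3}, ‖n‖ = 1 → ∀ v w : V3, |⟪v - w, n⟫_ℝ| * (1 - speedCutoff L ‖v‖ * speedCutoff L ‖w‖) ≤ (if L ^ 2 < ‖v‖ ^ 2 + ‖w‖ ^ 2 then 1 + ‖v‖ ^ 2 + ‖w‖ ^ 2 else 0) :=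
  fun hL _ hn v w => abs_inner_mul_one_sub_cc_le hL hn v w


end Summit.AtomisticToContinuum.HydrodynamicLimit.Theorems.ChaosClosesEulerPressureValue

end
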